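import Literature.MathematicalPhysics.QuantumLattice.HubbardOpenBoxCodedHamiltonian
import Literature.MathematicalPhysics.QuantumLattice.HubbardLiebConfig
import Mathlib.Algebra.Order.Ring.GeomSum
import HarnessLib

/-!
# Occupation codes, part 3: decoding, the coded spin sectors of the open box, and the transfer of
# sector sums to sums over the sector's code list

Topic `MathematicalPhysics/QuantumLattice`, family `hubbard`. Continues `HubbardOpenBoxOccupationCode`
/ `HubbardOpenBoxCodedHamiltonian` (Lin–Gubernatis bit-coded basis of the Hubbard model). For an
exact-diagonalisation certificate indexed by the POSITIONS of the codes of a spin sector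
`(N↑, N↓) = (p, q)` of the open `a × b` box one needs:

* `decode m` (the configuration with occupied orbitals = set bits of `m`), `decode_code`,
  `code_decode` (`m < 4^{ab}`), `code_lt` — `code` is a bijection onto `[0, 4^{ab})`;
* `upCount N m`, `dnCount N m` (set bits at even / odd positions `< 2N`) with
  `card_upPart_eq_upCount`, `card_downPart_eq_dnCount`;
* `sectorList a b p q` = the increasing list of codes `m < 4^{ab}` with `(upCount, dnCount) = (p, q)`
  (`mem_sectorList`, `nodup_sectorList`), and **`sum_sector_eq_sum_fin`**: a sum over the
  configurations of the spin sector `(p, q)` is the sum over the positions of `sectorList` of the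
  summand at the decoded code (Lin–Gubernatis 1993 §II: "the basis states of a sector are stored as an
  ordered list of integers and addressed by their position").

Everything is proved; no named fact.

## References

* H. Q. Lin, J. E. Gubernatis, Comput. Phys. 7 (1993) 400, §II. [cite: LinGubernatis1993, §II]
-/

namespace Literature.MathematicalPhysics.QuantumLattice

namespace OccupationCode

open Finset Matrix

section Box

variable {a b : ℕ}

/-! ### §1 Decoding -/

/-- The configuration whose occupied orbitals are the set bits of `m` (at the orbital ranks).
[cite: LinGubernatis1993, §II] -/
def decode (m : ℕ) : Finset (Orb (Fin a ×ₗ Fin b)) := univ.filter fun o => m.testBit (orbRank o) = true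

/-- Membership in `decode m`. [cite: LinGubernatis1993, §II] -/
theorem mem_decode (m : ℕ) (o : Orb (Fin a ×ₗ Fin b)) : o ∈ (decode m : Finset (Orb (Fin a ×ₗ Fin b))) ↔
    m.testBit (orbRank o) = true := by
  simp [decode]

/-- `decode (code s) = s`. [cite: LinGubernatis1993, §II] -/
theorem decode_code (s : Finset (Orb (Fin a ×ₗ Fin b))) : decode (code s) = s := by
  ext o
  rw [mem_decode, ← mem_iff_testBit_code]

/-- Every bit position `r < 2ab` is the rank of an orbital of the box. [cite: LinGubernatis1993, §II] -/
theorem exists_orbRank_eq {r : ℕ} (hr : r < 2 * (a * b)) : ∃ o : Orb (Fin a ×ₗ Fin b), orbRank o = r := by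
  have hP : r / 2 < a * b := by omega
  have hb : 0 < b := Nat.pos_of_ne_zero fun h => by subst h; simp at hP
  have hi : r / 2 / b < a := Nat.div_lt_of_lt_mul (by rwa [Nat.mul_comm] at hP)
  have hj : r / 2 % b < b := Nat.mod_lt _ hb
  have hσ : r % 2 < 2 := Nat.mod_lt _ (by norm_num)
  refine ⟨toLex (toLex ((⟨r / 2 / b, hi⟩ : Fin a), (⟨r / 2 % b, hj⟩ : Fin b)), (⟨r % 2, hσ⟩ : Fin 2)), ?_⟩
  simp only [orbRank, siteRank, ofLex_toLex]
  have h1 := Nat.div_add_mod (r / 2) b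
  have h2 := Nat.div_add_mod r 2
  rw [Nat.mul_comm] at h1
  omega

/-- A set bit of `m < 4^{ab}` lies below `2ab`. [folklore] -/
private theorem lt_of_testBit {m r : ℕ} (hm : m < 4 ^ (a * b)) (h : m.testBit r = true) : r < 2 * (a * b) := by
  rcases lt_or_ge r (2 * (a * b)) with hr | hr
  · exact hr
  · exfalso
    have h4 : (4 : ℕ) ^ (a * b) = 2 ^ (2 * (a * b)) := by rw [show (4 : ℕ) = 2 ^ 2 by norm_num, ← pow_mul]
    have : m < 2 ^ r := lt_of_lt_of_le (h4 ▸ hm) (Nat.pow_le_pow_right (by norm_num) hr)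
    rw [Nat.testBit_eq_false_of_lt this] at h
    exact Bool.false_ne_true h

/-- `code (decode m) = m` for `m < 4^{ab}`. [cite: LinGubernatis1993, §II] -/
theorem code_decode {m : ℕ} (hm : m < 4 ^ (a * b)) : code (decode m : Finset (Orb (Fin a ×ₗ Fin b))) = m := by
  rw [code_eq_natCode_image, natCode]
  have himg : (decode m : Finset (Orb (Fin a ×ₗ Fin b))).image orbRank = m.bitIndices.toFinset := by
    ext r
    simp only [mem_image, mem_decode, List.mem_toFinset, Nat.mem_bitIndices]
    constructor
    · rintro ⟨o, ho, rfl⟩; exact ho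
    · intro h
      obtain ⟨o, rfl⟩ := exists_orbRank_eq (a := a) (b := b) (lt_of_testBit hm h)
      exact ⟨o, h, rfl⟩
  rw [himg]
  exact Finset.sum_toFinset_bitIndices_two_pow m

/-- Codes are `< 4^{ab}`. [cite: LinGubernatis1993, §II] -/
theorem code_lt (s : Finset (Orb (Fin a ×ₗ Fin b))) : code s < 4 ^ (a * b) := by
  rw [code_eq_natCode_image, natCode,
    show (4 : ℕ) ^ (a * b) = 2 ^ (2 * (a * b)) by rw [show (4 : ℕ) = 2 ^ 2 by norm_num, ← pow_mul]]
  refine Nat.geomSum_lt le_rfl fun r hr => ?_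
  obtain ⟨o, _, rfl⟩ := mem_image.1 hr
  exact orbRank_lt o

/-! ### §2 Spin counts -/

/-- Number of set bits at the even positions `2P`, `P < N` (up electrons). [cite: LinGubernatis1993, §II] -/
def upCount (N m : ℕ) : ℕ := sumNat (fun P => if m.testBit (2 * P) then 1 else 0) N

/-- Number of set bits at the odd positions `2P + 1`, `P < N` (down electrons). [cite: LinGubernatis1993, §II] -/
def dnCount (N m : ℕ) : ℕ := sumNat (fun P => if m.testBit (2 * P + 1) then 1 else 0) N

/-- `#(upPart s) = upCount (ab) (code s)`. [cite: LinGubernatis1993, §II] -/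
theorem card_upPart_eq_upCount (s : Finset (Orb (Fin a ×ₗ Fin b))) : (upPart s).card = upCount (a * b) (code s) := by
  rw [upCount, ← sum_site_eq_sumNat, upPart, card_filter]
  refine Finset.sum_congr rfl fun x _ => ?_
  have h := mem_iff_testBit_code s (orb x 0)
  rw [orbRank_orb] at h
  simp only [Fin.val_zero, add_zero] at h
  by_cases hx : orb x 0 ∈ s
  · rw [if_pos hx, if_pos (h.1 hx)]
  · rw [if_neg hx, if_neg (fun h' => hx (h.2 h'))]

/-- `#(downPart s) = dnCount (ab) (code s)`. [cite: LinGubernatis1993, §II] -/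
theorem card_downPart_eq_dnCount (s : Finset (Orb (Fin a ×ₗ Fin b))) :
    (downPart s).card = dnCount (a * b) (code s) := by
  rw [dnCount, ← sum_site_eq_sumNat, downPart, card_filter]
  refine Finset.sum_congr rfl fun x _ => ?_
  have h := mem_iff_testBit_code s (orb x 1)
  rw [orbRank_orb] at h
  simp only [Fin.val_one] at h
  by_cases hx : orb x 1 ∈ s
  · rw [if_pos hx, if_pos (h.1 hx)]
  · rw [if_neg hx, if_neg (fun h' => hx (h.2 h'))]

/-! ### §3 The code list of a spin sector and the transfer of sector sums -/

/-- **The code list of the spin sector `(N↑, N↓) = (p, q)`** of the open `a × b` box: the codes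
`m < 4^{ab}` with `upCount = p`, `dnCount = q`, in increasing order. [cite: LinGubernatis1993, §II] -/
def sectorList (a b p q : ℕ) : List ℕ :=
  (List.range (4 ^ (a * b))).filter fun m => upCount (a * b) m = p ∧ dnCount (a * b) m = q

/-- Membership in the sector list. [cite: LinGubernatis1993, §II] -/
theorem mem_sectorList {p q m : ℕ} :
    m ∈ sectorList a b p q ↔ m < 4 ^ (a * b) ∧ upCount (a * b) m = p ∧ dnCount (a * b) m = q := by
  simp [sectorList, List.mem_filter]

/-- The sector list has no duplicates. [cite: LinGubernatis1993, §II] -/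
theorem nodup_sectorList (p q : ℕ) : (sectorList a b p q).Nodup :=
  (List.nodup_range).filter _

/-- The spin sector `(p, q)` as a set of configurations (`= {s | spinConfig p q s}`). [cite: LinGubernatis1993, §II] -/
def sectorConfigs (a b p q : ℕ) : Finset (Finset (Orb (Fin a ×ₗ Fin b))) :=
  univ.filter fun s => (upPart s).card = p ∧ (downPart s).card = q

/-- Membership in `sectorConfigs`. [cite: LinGubernatis1993, §II] -/
theorem mem_sectorConfigs {p q : ℕ} {s : Finset (Orb (Fin a ×ₗ Fin b))} :
    s ∈ sectorConfigs a b p q ↔ (upPart s).card = p ∧ (downPart s).card = q := by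
  simp [sectorConfigs]

/-- A configuration is in the sector iff its code is in the sector list. [cite: LinGubernatis1993, §II] -/
theorem mem_sectorConfigs_iff_code_mem {p q : ℕ} {s : Finset (Orb (Fin a ×ₗ Fin b))} :
    s ∈ sectorConfigs a b p q ↔ code s ∈ sectorList a b p q := by
  rw [mem_sectorConfigs, mem_sectorList, card_upPart_eq_upCount, card_downPart_eq_dnCount]
  exact ⟨fun h => ⟨code_lt s, h⟩, fun h => h.2⟩

/-- **Transfer of sector sums to the code list**: a sum over the configurations of the spin sector
`(p, q)` is the sum, over the positions `i` of `sectorList a b p q`, of the summand at the decoded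
`i`-th code. [cite: LinGubernatis1993, §II] -/
theorem sum_sector_eq_sum_fin {M : Type*} [AddCommMonoid M] (p q : ℕ)
    (F : Finset (Orb (Fin a ×ₗ Fin b)) → M) :
    ∑ s ∈ sectorConfigs a b p q, F s =
      ∑ i : Fin (sectorList a b p q).length, F (decode ((sectorList a b p q)[i])) := by
  classical
  -- positions ↔ list elements ↔ configurations
  have h1 : ∑ i : Fin (sectorList a b p q).length, F (decode ((sectorList a b p q)[i])) =
      ∑ m ∈ (sectorList a b p q).toFinset, F (decode m) := by
    rw [List.sum_toFinset _ (nodup_sectorList p q), ← List.sum_ofFn]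
    congr 1
    exact (List.ofFn_getElem_eq_map (sectorList a b p q) (fun m => F (decode m)))
  rw [h1]
  refine Finset.sum_nbij' code (fun m => decode m) ?_ ?_ ?_ ?_ ?_
  · intro s hs
    exact List.mem_toFinset.2 (mem_sectorConfigs_iff_code_mem.1 hs)
  · intro m hm
    have hm' := mem_sectorList.1 (List.mem_toFinset.1 hm)
    rw [mem_sectorConfigs_iff_code_mem, code_decode hm'.1]
    exact List.mem_toFinset.1 hm
  · intro s _
    exact decode_code s
  · intro m hm
    exact code_decode (mem_sectorList.1 (List.mem_toFinset.1 hm)).1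
  · intro s _
    rw [decode_code]

/-- The `i`-th code of the sector list decodes to a configuration of the sector. [cite: LinGubernatis1993, §II] -/
theorem decode_getElem_mem_sectorConfigs (p q : ℕ) (i : Fin (sectorList a b p q).length) :
    (decode ((sectorList a b p q)[i]) : Finset (Orb (Fin a ×ₗ Fin b))) ∈ sectorConfigs a b p q := by
  have hm : (sectorList a b p q)[i] ∈ sectorList a b p q := List.getElem_mem _
  rw [mem_sectorConfigs_iff_code_mem, code_decode (mem_sectorList.1 hm).1]
  exact hm

/-- The codes of the sector list are pairwise distinct by position. [cite: LinGubernatis1993, §II] -/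
theorem getElem_sectorList_injective (p q : ℕ) :
    Function.Injective fun i : Fin (sectorList a b p q).length => (sectorList a b p q)[i] := by
  intro i j h
  exact Fin.ext ((nodup_sectorList p q).getElem_inj_iff.1 h)

end Box

end OccupationCode

end Literature.MathematicalPhysics.QuantumLattice
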